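import Summits.ResolutionOfSingularities.ResolutionOfSingularities.Theorems.FrobeniusClosingPatchingRelPerfectDepthOneTargetsDefs
import Literature.AlgebraicGeometry.Resolution.MonomialMarkedIdeals
import Literature.AlgebraicGeometry.Resolution.BlowupSequences
import Literature.AlgebraicGeometry.Resolution.BlowupsComposition
import Literature.AlgebraicGeometry.Resolution.KollarOrderReduction
import Literature.AlgebraicGeometry.Resolution.MarkedIdealsLemmas
import HarnessLib

/-!
# Crux `PatchingRelPerfect` (stmt-ResolutionOfSingularities-16161), chain w52 — TARGETS F3:
# the MONOMIAL RUNG «R-mono» (fact-free, every characteristic, every dimension)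

[OURS · L1 W5.2 · CRUX-PLAN v3.3 §6j / §7] Planner file (res-L1-w52-plan-1 gen 6): TYPED TARGETS and the
KERNEL-CHECKED COMPOSITION of the monomial rung of the core class,

  «for a regular local ring `S` with regular system of parameters `x₁, …, xₙ`, EVERY `𝔪`-primary
   MONOMIAL ideal `I = (x^α : α ∈ A)` has a companion: `∃ Q ⊇ 𝔪^m` with `Bl_{I·Q} Spec S` regular»

— the first infinite family of members of ALL exceptional depths `ℓ` (`(x^α) + 𝔪^{|α|+ℓ}`,
`(x₁^a x₂^b, x₃^c) + 𝔪^N`, …), with no literature fact consumed.  MECHANISM (the planner's kernel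
sentence v1.6, «monomial contact»): on `X₀ = Bl_𝔪 Spec S` (regular, r0) the strict transforms `D̂_j` of
the coordinate hyperplanes `V(x_j)` and the exceptional divisor `E` form a simple normal crossings system,
and `I𝒪_{X₀} = 𝓘_E^e · K` with `K` a finite SUM OF MONOMIALS in that system whose cosupport lies in `E`
(`𝔪^N ⊆ I`); `K` is principalized by blowing up snc strata inside its cosupport (res-L1-w52-stub-4's
monomial principalization, pair case = `AdmitsStratumPrincipalization`, p499271 + sequel), all centres
lie over the closed point, the top is regular and `I𝒪` becomes locally principal there; the tree's
`DepthOneTargets.TowerContraction` (D5, p493249 content) contracts the tower to ONE blow-up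
`Bl_{I·Q} Spec S`, `Q ⊇ 𝔪^m`.

Contents: `monomialSum` (the sum of the monomial ideals of a family of exponent lists) · TARGET
`MonomialFormat` (M1, fact-free M/L: the package on `Bl_𝔪`) · TARGET `MonomialSumPrincipalization`
(M2 = stub-4's theorem in the shape consumed here) · TARGET `ClosedPointTower` (M3, S: a `CentreSeq`
with centres over the closed point on top of a closed-point-supported blow-up is again one) ·
`MonomialConclusion` and the PROVED composition `monomial_of_targets : MonomialFormat →
MonomialSumPrincipalization → ClosedPointTower → TowerContraction → MonomialConclusion`.
LANDING RULE as F1/F2: one filer lands the defs block verbatim, targets are then closed BY NAME.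
Everything here is OURS; statements are fact-free; nothing is a statement of the manuscript under review.
-/

universe u

set_option linter.dupNamespace false

open CategoryTheory AlgebraicGeometry Literature.AlgebraicGeometry.Resolution

namespace Summit.ResolutionOfSingularities.ResolutionOfSingularities.Theorems.DepthTargets

open DepthOneTargets (TowerContraction)

/-! ## §1 Definitions -/

/-- [OURS · W5.2 F3] The sum `Σ_i Π_j 𝓘_{E^j}^{a_{ij}}` of the monomial ideals of a finite family of exponent
lists (`monomialIdeal`, `Resolution/MonomialMarkedIdeals.lean`) — locally `(z^{a_1}, …, z^{a_r})` in a
regular system of parameters adapted to the boundary. -/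
def monomialSum {X : Scheme.{u}} (𝒦 : List (List (X.IdealSheafData × ℕ))) : X.IdealSheafData :=
  (𝒦.map monomialIdeal).foldr (· ⊔ ·) ⊥

/-- [OURS · W5.2 F3] The monomial ideal `(x^α : α ∈ A)` of a finite set of exponent vectors in the
elements `x₁, …, xₙ`. -/
def monomialSpan {S : Type u} [CommRing S] {n : ℕ} (x : Fin n → S) (A : Finset (Fin n → ℕ)) : Ideal S :=
  Ideal.span ((fun α : Fin n → ℕ => ∏ j, x j ^ α j) '' (A : Set (Fin n → ℕ)))

/-! ## §2 Targets -/

/-- [OURS · W5.2 F3 · TARGET M1 «MONOMIAL FORMAT», fact-free M/L] For a regular local `S` with regular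
system of parameters `x` (it spans `𝔪`, `n = dim S`) and an `𝔪`-primary monomial ideal `I = (x^α : α ∈ A)`:
a blow-up `g : X ⟶ Spec S` of `𝔪` with `X` regular and Noetherian, a simple normal crossings system `Es`
on `X` containing the (locally principal) exceptional ideal `ℰ` — the strict transforms of the `V(x_j)`
and `E` — and a non-empty family `𝒦` of exponent lists on `Es` with `I𝒪_X = ℰ^e · monomialSum 𝒦` and
the cosupport of `monomialSum 𝒦` over the closed point (from `𝔪^N ⊆ I`: `ℰ^{N-e} ⊆ monomialSum 𝒦`);
also `I ≠ ⊥`.  Route: `X := Bl_𝔪 Spec S` (r0: regular); on the chart `x_i ≠ 0`,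
`x^α = x_i^{|α|} · Π_{j ≠ i} (x_j/x_i)^{α_j}` and `(x_i, x_j/x_i (j ≠ i))` is a regular system of parameters. -/
def MonomialFormat : Prop :=
  ∀ (S : Type u) [CommRing S] [IsRegularLocalRing S] (n : ℕ) (x : Fin n → S),
    Ideal.span (Set.range x) = IsLocalRing.maximalIdeal S → (n : WithBot ℕ∞) = ringKrullDim S →
    ∀ (A : Finset (Fin n → ℕ)), A.Nonempty →
    ∀ (N : ℕ), IsLocalRing.maximalIdeal S ^ N ≤ monomialSpan x A →
      monomialSpan x A ≠ ⊥ ∧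
      ∃ (X : Scheme.{u}) (g : X ⟶ Spec (.of S)) (Es : List X.IdealSheafData) (ℰ : X.IdealSheafData)
        (𝒦 : List (List (X.IdealSheafData × ℕ))) (e : ℕ),
        IsBlowup g (affineBlowup.idealSheaf (IsLocalRing.maximalIdeal S)) ∧ Scheme.IsRegular X ∧
        IsNoetherian X ∧ HasSNC Es ∧ ℰ ∈ Es ∧ IsLocallyPrincipal ℰ ∧
        (∀ K ∈ 𝒦, boundaryOf K = Es) ∧ 𝒦 ≠ [] ∧
        ((monomialSum 𝒦).support : Set X) ⊆ g ⁻¹' {IsLocalRing.closedPoint S} ∧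
        (affineBlowup.idealSheaf (monomialSpan x A)).comap g = ℰ ^ e * monomialSum 𝒦

/-- [OURS · W5.2 F3 · TARGET M2 «MONOMIAL SUM PRINCIPALIZATION», fact-free — res-L1-w52-stub-4's
theorem (pair case `AdmitsStratumPrincipalization`, …MonomialPairBookkeeping.lean p499271 + sequel,
then finite sums) in the shape consumed here] On a regular Noetherian scheme, a finite non-empty sum of
monomial ideals on a common simple normal crossings boundary is principalized by a sequence of blowings up
with regular centres lying over its cosupport, with regular top.  (Goward's principalization of monomial
ideals by codimension-two strata; Kollár (3.111) Step 3 is the single-monomial marked case, in the tree as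
`exists_isResolutionOf_monomialMarked`.) -/
def MonomialSumPrincipalization : Prop :=
  ∀ (X : Scheme.{u}) [IsNoetherian X], Scheme.IsRegular X →
    ∀ (Es : List X.IdealSheafData), HasSNC Es →
    ∀ (𝒦 : List (List (X.IdealSheafData × ℕ))), (∀ K ∈ 𝒦, boundaryOf K = Es) → 𝒦 ≠ [] →
      ∃ s : CentreSeq X, s.AllRegular ∧ s.CentresOver ((monomialSum 𝒦).support : Set X) ∧
        Scheme.IsRegular s.top ∧ IsLocallyPrincipal ((monomialSum 𝒦).comap s.comp)

/-- [OURS · W5.2 F3 · TARGET M3 «CLOSED-POINT TOWER», S] A sequence of blowings up whose centres lie over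
the closed point, on top of a blow-up of `Spec S` along a closed-point-supported ideal, composes to a
blow-up of `Spec S` along a closed-point-supported ideal (induction on the sequence with the tree's
`IsBlowup.exists_isBlowup_comp_supported`, Resolution/BlowupsComposition.lean). -/
def ClosedPointTower : Prop :=
  ∀ (S : Type u) [CommRing S] [IsNoetherianRing S] [IsLocalRing S] (X : Scheme.{u})
    (g : X ⟶ Spec (.of S)) (K₀ : (Spec (.of S)).IdealSheafData),
    IsBlowup g K₀ → (K₀.support : Set (Spec (.of S))) ⊆ {IsLocalRing.closedPoint S} →
    ∀ (s : CentreSeq X), s.CentresOver (g ⁻¹' {IsLocalRing.closedPoint S}) →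
      ∃ K₁ : (Spec (.of S)).IdealSheafData,
        IsBlowup (s.comp ≫ g) K₁ ∧ (K₁.support : Set (Spec (.of S))) ⊆ {IsLocalRing.closedPoint S}

/-- [OURS · W5.2 F3 · the monomial rung's conclusion] Every `𝔪`-primary monomial ideal of a regular local
ring (monomial in a regular system of parameters) has a companion: `∃ Q ⊇ 𝔪^m` with `Bl_{I·Q} Spec S`
regular — the companion form of membership in the core class (cf. `DepthOneTargets.DepthOneConclusion`,
`depthOne_companion` p498225). -/
def MonomialConclusion : Prop :=
  ∀ (S : Type u) [CommRing S] [IsRegularLocalRing S] (n : ℕ) (x : Fin n → S),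
    Ideal.span (Set.range x) = IsLocalRing.maximalIdeal S → (n : WithBot ℕ∞) = ringKrullDim S →
    ∀ (A : Finset (Fin n → ℕ)), A.Nonempty →
    ∀ (N : ℕ), IsLocalRing.maximalIdeal S ^ N ≤ monomialSpan x A →
      ∃ (Q : Ideal S) (m : ℕ), IsLocalRing.maximalIdeal S ^ m ≤ Q ∧
        ∃ (B : Scheme.{u}) (b : B ⟶ Spec (.of S)),
          IsBlowup b (affineBlowup.idealSheaf (monomialSpan x A * Q)) ∧ Scheme.IsRegular B

/-! ## §3 The composition (PROVED): R-mono from M1, M2, M3 and D5 -/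

/-- [OURS · W5.2 F3] **The monomial rung, assembled**: `MonomialFormat → MonomialSumPrincipalization →
ClosedPointTower → TowerContraction → MonomialConclusion`.  Format `I𝒪_X = ℰ^e·K` on the regular blow-up
`X` of `𝔪`; principalize `K` by strata over its cosupport (over the closed point); the tower composes to one
closed-point-supported blow-up with regular top on which `I𝒪 = (ℰ𝒪)^e · K𝒪` is locally principal; contract
(D5). -/
theorem monomial_of_targets (hM1 : MonomialFormat.{u}) (hM2 : MonomialSumPrincipalization.{u})
    (hM3 : ClosedPointTower.{u}) (hD5 : TowerContraction.{u}) : MonomialConclusion.{u} := by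
  intro S _ _ n x hx hn A hA N hN
  obtain ⟨hI, X, g, Es, ℰ, 𝒦, e, hg, hXreg, hXnoeth, hEs, -, hℰlp, h𝒦, h𝒦ne, hsupp, hfmt⟩ :=
    hM1 S n x hx hn A hA N hN
  haveI := hXnoeth
  obtain ⟨s, -, hover, htop, hlp⟩ := hM2 X hXreg Es hEs 𝒦 h𝒦 h𝒦ne
  have hover' : s.CentresOver (g ⁻¹' {IsLocalRing.closedPoint S}) := CentreSeq.CentresOver.mono s hsupp hover
  have hg𝔪 : ((affineBlowup.idealSheaf (IsLocalRing.maximalIdeal S)).support : Set (Spec (.of S))) ⊆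
      {IsLocalRing.closedPoint S} := by
    intro p hp
    exact support_idealSheaf_subset_closedPoint (Q := IsLocalRing.maximalIdeal S) (n := 1)
      (by rw [pow_one]) p hp
  obtain ⟨K₁, hK₁, hK₁supp⟩ := hM3 S X g _ hg hg𝔪 s hover'
  refine hD5 S (monomialSpan x A) hI s.top (s.comp ≫ g) K₁ hK₁ hK₁supp htop ?_
  rw [Scheme.IdealSheafData.comap_comp, hfmt, comap_mul, comap_pow]
  exact ((hℰlp.comap _).pow e).mul hlp

end Summit.ResolutionOfSingularities.ResolutionOfSingularities.Theorems.DepthTargets
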